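import Mathlib
import Literature.NumberTheory.Sieve.RoughDivisorPowerSums
import Literature.NumberTheory.Sieve.BombieriAsymptoticSieveMertens
import Literature.NumberTheory.Sieve.ParityBarrierLevelProofs
import Summits.Parity.GeneralizedHardyLittlewood.Theorems.ParityLeakOneFifthPlainSplitCalibReduction
import Summits.Parity.GeneralizedHardyLittlewood.Theorems.ParityLeakOneFifthParityLeakSieveTypeIPerD
import Summits.Parity.GeneralizedHardyLittlewood.Theorems.ParityLeakOneFifthParityLeakSieveTypeISum
import Summits.Parity.GeneralizedHardyLittlewood.Theorems.ParityLeakOneFifthParityLeakSieveTypeITail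
import Summits.Parity.GeneralizedHardyLittlewood.Theorems.ParityLeakOneFifthParityLeakSieveTypeIAux
import Summits.Parity.GeneralizedHardyLittlewood.Theorems.ParityLeakOneFifthParityLeakSieveCorner
import Summits.Parity.GeneralizedHardyLittlewood.Theorems.ParityLeakOneFifthParityLeakSieveErrCells
import HarnessLib

/-!
# Route ParityLeakOneFifth, crux `ParityLeakSieve` (stmt-Parity-18381), skeleton `birth`:
# the Type-I comparison of stub S1 — `|Σ_n (a(n) − b(n)) Θ_w(n+2)| ≤ δ x/log x`

With `Θ_w(m) = 1[x^{ε²} ≤ P⁻(m)]·G(m)`: for `δ > 0`, `0 < ε ≤ ε₀(δ)` and `x ≥ x₀(ε)`,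
`|Σ_{x<n≤2x} (a(n) − b(n)) Θ_w(n+2)| ≤ δ x/log x` (`typeI_diff_le`): decomposition over the moduli `d`
(`typeI_decomp`), the bound for one `d` (`typeI_per_d_bound`: fundamental lemma for the host at level
`L = x^ε`, interval sieve for the model, main-term matching), the host remainders summed by
Bombieri–Vinogradov (`PrimesHaveLevel (1/2 − ε/2)` from `BombieriVinogradovStatement_holds`) after the
injective re-indexing `q = de ≤ x^{1/2−ε}` (`sum_pairs_le_sum_Icc`).
-/

namespace Summit.Parity.GeneralizedHardyLittlewood.Theorems.ParityLeakOneFifth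

open Finset Real Filter
open scoped ArithmeticFunction.Moebius ArithmeticFunction.vonMangoldt ArithmeticFunction.sigma Chebyshev
open Literature.NumberTheory.Sieve

set_option maxHeartbeats 10000000 in
/-- **The Type-I comparison.** For every `δ > 0` there is `ε₀ > 0` such that for `0 < ε ≤ ε₀` and
`x ≥ x₀(ε)`: `|Σ_{x<n≤2x} (a(n) − b(n))·1[x^{ε²} ≤ P⁻(n+2)]·G(n+2)| ≤ δ x/log x`. -/
theorem typeI_diff_le : ∀ δ : ℝ, 0 < δ → ∃ ε₀ : ℝ, 0 < ε₀ ∧ ∀ ε : ℝ, 0 < ε → ε ≤ ε₀ →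
    ∃ x₀ : ℕ, ∀ x : ℕ, x₀ ≤ x → ∀ (z V : ℝ) (G : ℕ → ℝ),
      z = Real.exp (Real.log (Real.log (x : ℝ)) ^ 2) →
      V = ∏ p ∈ (Finset.range ⌈z⌉₊).filter Nat.Prime, (1 - 1 / (p : ℝ)) →
      G = (fun m : ℕ => ∑ d ∈ (Nat.divisors m).filter (fun d : ℕ => (d : ℝ) ≤ (x : ℝ) ^ ((1 : ℝ) / 2 - 2 * ε) ∧
        ∀ p ∈ d.primeFactors, (x : ℝ) ^ ((1 : ℝ) / 5) ≤ (p : ℝ)), (ArithmeticFunction.moebius d : ℝ)) →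
      |∑ n ∈ Finset.Ioc x (2 * x), ((if n.Prime then Real.log (n : ℝ) else 0) -
          (if ∀ p ∈ n.primeFactors, z ≤ (p : ℝ) then 1 / V else 0)) *
          (if (x : ℝ) ^ (ε ^ 2) ≤ ((n + 2).minFac : ℝ) then G (n + 2) else 0)| ≤
        δ * (x : ℝ) / Real.log (x : ℝ) := by
  intro δ hδ
  obtain ⟨C₁, Cb, hC₁, hCb, hPER⟩ := typeI_per_d_bound
  obtain ⟨CR, hCR, hRough⟩ := RoughSums.exists_sum_rough_sigma_zero_pow_div_le' 0
  obtain ⟨c, hc, hVlow⟩ := exists_V_lower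
  obtain ⟨S₁, hS₁def⟩ : ∃ S : ℝ, S = 5 / 2 * CR := ⟨_, rfl⟩
  have hS₁0 : 0 < S₁ := by rw [hS₁def]; positivity
  obtain ⟨K, hK⟩ : ∃ K : ℝ, K = 30 * S₁ * (4 * C₁ + 2 * Cb) + 1 := ⟨_, rfl⟩
  have hK0 : 0 < K := by rw [hK]; positivity
  refine ⟨min (1 / 25) (δ / K), by positivity, fun ε hε hεle => ?_⟩
  have hε25 : ε ≤ 1 / 25 := hεle.trans (min_le_left _ _)
  have hεK : ε ≤ δ / K := hεle.trans (min_le_right _ _)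
  -- Bombieri–Vinogradov at level `x^{1/2 − ε}`
  have hBVst := Literature.NumberTheory.Sieve.BombieriVinogradovStatement_holds (1 / 2 - ε / 2) (by linarith)
  obtain ⟨CB, hCB⟩ := (hBVst 3 (by norm_num) (ε / 2) (by positivity)).bound
  obtain ⟨X₀, hX₀⟩ := Filter.eventually_atTop.1 hCB
  have hCB0 : 0 ≤ CB := by
    have h := hX₀ (max X₀ 3) (le_max_left _ _)
    have h3 : (3 : ℝ) ≤ max X₀ 3 := le_max_right _ _
    have hpos : 0 < ‖max X₀ 3 / Real.log (max X₀ 3) ^ (3 : ℝ)‖ := by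
      rw [Real.norm_of_nonneg]
      · apply div_pos (by linarith)
        exact Real.rpow_pos_of_pos (Real.log_pos (by linarith)) _
      · apply div_nonneg (by linarith)
        exact (Real.rpow_pos_of_pos (Real.log_pos (by linarith)) _).le
    have := (norm_nonneg _).trans h
    nlinarith
  -- growth thresholds in `ℓ = log x`
  obtain ⟨L₁, -, hL₁⟩ := exists_pow_le_mul_exp 2 (κ := ε ^ 2) (a := 1) (by positivity) one_pos
  obtain ⟨L₂, -, hL₂⟩ := exists_pow_le_mul_exp 1 (κ := δ / (60 * S₁)) (a := 1 / 5) (by positivity) (by norm_num)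
  obtain ⟨L₃, -, hL₃⟩ := exists_pow_le_mul_exp 1 (κ := δ / (10 * (2 + Cb))) (a := 1 / 2) (by positivity) (by norm_num)
  obtain ⟨L₄, -, hL₄⟩ := exists_pow_le_mul_exp 5 (κ := c * δ / 10) (a := 21 / 50) (by positivity) (by norm_num)
  obtain ⟨L₅, -, hL₅⟩ := exists_pow_le_mul_exp 2 (κ := δ / 30) (a := ε) (by positivity) hε
  obtain ⟨M, hM⟩ : ∃ M : ℝ, M = max (max (max (Real.exp L₁) (40 * S₁ / δ + 3)) (max L₂ L₃))
    (max (max L₄ L₅) (max (20 * CB / δ + 1) (Real.exp 2))) := ⟨_, rfl⟩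
  obtain ⟨x₁, hx₁⟩ := exists_nat_loglog_ge (Real.log M)
  refine ⟨max (max x₁ (2 ^ 100)) ⌈X₀⌉₊, fun x hx => ?_⟩
  rintro z V G hz hV hG
  have hxx₁ : x₁ ≤ x := ((le_max_left _ _).trans (le_max_left _ _)).trans hx
  have hx100 : 2 ^ 100 ≤ x := ((le_max_right _ _).trans (le_max_left _ _)).trans hx
  have hxX₀ : X₀ ≤ (x : ℝ) := (Nat.le_ceil _).trans (by exact_mod_cast (le_max_right _ _).trans hx)
  obtain ⟨hxE, hlogx, -⟩ := hx₁ x hxx₁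
  obtain ⟨hy1, hD1, hwy, hDy3, hD2x, hyx, -, -, -⟩ := calib_growth hε hε25 hx100
  -- the scales
  obtain ⟨ℓ, hℓ⟩ : ∃ l : ℝ, l = Real.log (x : ℝ) := ⟨_, rfl⟩
  have hM1 : Real.exp L₁ ≤ M := by rw [hM]; exact ((le_max_left _ _).trans (le_max_left _ _)).trans (le_max_left _ _)
  have hM2 : 40 * S₁ / δ + 3 ≤ M := by rw [hM]; exact ((le_max_right _ _).trans (le_max_left _ _)).trans (le_max_left _ _)
  have hM3 : L₂ ≤ M := by rw [hM]; exact ((le_max_left _ _).trans (le_max_right _ _)).trans (le_max_left _ _)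
  have hM4 : L₃ ≤ M := by rw [hM]; exact ((le_max_right _ _).trans (le_max_right _ _)).trans (le_max_left _ _)
  have hM5 : L₄ ≤ M := by rw [hM]; exact ((le_max_left _ _).trans (le_max_left _ _)).trans (le_max_right _ _)
  have hM6 : L₅ ≤ M := by rw [hM]; exact ((le_max_right _ _).trans (le_max_left _ _)).trans (le_max_right _ _)
  have hM7 : 20 * CB / δ + 1 ≤ M := by rw [hM]; exact ((le_max_left _ _).trans (le_max_right _ _)).trans (le_max_right _ _)
  have hM8 : Real.exp 2 ≤ M := by rw [hM]; exact ((le_max_right _ _).trans (le_max_right _ _)).trans (le_max_right _ _)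
  have hMpos : 0 < M := lt_of_lt_of_le (Real.exp_pos 2) hM8
  have hℓM : M ≤ ℓ := by rw [Real.exp_log hMpos] at hlogx; rw [hℓ]; exact hlogx
  have hℓ3 : 3 ≤ ℓ := by
    have : 0 ≤ 40 * S₁ / δ := by positivity
    linarith
  have hℓ0 : 0 < ℓ := by linarith
  have hx0 : (0 : ℝ) < x := (Real.exp_pos _).trans_le hxE
  have hx1 : (1 : ℝ) < x := by
    have : (2 : ℕ) ^ 100 ≤ x := hx100
    have h2 : 1 < (2 : ℕ) ^ 100 := by norm_num
    exact_mod_cast h2.trans_le this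
  have hx1' : 1 ≤ x := by exact_mod_cast hx1.le
  have hxℓ : (x : ℝ) = Real.exp ℓ := by rw [hℓ, Real.exp_log hx0]
  obtain ⟨t, ht⟩ : ∃ t : ℝ, t = Real.log ℓ := ⟨_, rfl⟩
  have ht2 : 2 ≤ t := by
    rw [ht, Real.le_log_iff_exp_le hℓ0]; exact hM8.trans hℓM
  have ht0 : 0 < t := by linarith
  have htℓ : t ≤ ℓ := by rw [ht]; have := Real.log_le_sub_one_of_pos hℓ0; linarith
  have hexpt : Real.exp t = ℓ := by rw [ht, Real.exp_log hℓ0]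
  have hz' : z = Real.exp (t ^ 2) := by rw [hz, ← hℓ, ← ht]
  have hz2 : 2 < z := by
    rw [hz']
    have h1 : Real.exp 1 ≤ Real.exp (t ^ 2) := Real.exp_le_exp.2 (by nlinarith only [ht2])
    have h2 : (2 : ℝ) < Real.exp 1 := by have := Real.exp_one_gt_d9; linarith
    linarith
  have hlogz : Real.log z = t ^ 2 := by rw [hz', Real.log_exp]
  obtain ⟨y, hy⟩ : ∃ v : ℝ, v = (x : ℝ) ^ ((1 : ℝ) / 5) := ⟨_, rfl⟩
  obtain ⟨D, hD⟩ : ∃ v : ℝ, v = (x : ℝ) ^ ((1 : ℝ) / 2 - 2 * ε) := ⟨_, rfl⟩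
  obtain ⟨w, hw⟩ : ∃ v : ℝ, v = (x : ℝ) ^ (ε ^ 2) := ⟨_, rfl⟩
  obtain ⟨L, hLdef⟩ : ∃ v : ℝ, v = (x : ℝ) ^ ε := ⟨_, rfl⟩
  rw [← hy] at hy1 hyx
  rw [← hD] at hD1 hD2x
  rw [← hw, ← hy] at hwy
  rw [← hD, ← hy] at hDy3
  have hy0 : 0 < y := by linarith
  have hD0 : 0 < D := by linarith
  have hw0 : 0 < w := by rw [hw]; exact Real.rpow_pos_of_pos hx0 _
  have hLpos : 0 < L := by rw [hLdef]; exact Real.rpow_pos_of_pos hx0 _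
  have hlogw : Real.log w = ε ^ 2 * ℓ := by rw [hw, Real.log_rpow hx0, hℓ]
  have hlogL : Real.log L = ε * ℓ := by rw [hLdef, Real.log_rpow hx0, hℓ]
  have hlogy : Real.log y = ℓ / 5 := by rw [hy, Real.log_rpow hx0, hℓ]; ring
  have hyexp : y = Real.exp (ℓ / 5) := by rw [← hlogy, Real.exp_log hy0]
  have hwexp : w = Real.exp (ε ^ 2 * ℓ) := by rw [← hlogw, Real.exp_log hw0]
  have hLexp : L = Real.exp (ε * ℓ) := by rw [← hlogL, Real.exp_log hLpos]
  have hDexp : D = Real.exp ((1 / 2 - 2 * ε) * ℓ) := by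
    rw [← Real.exp_log hD0]; congr 1; rw [hD, Real.log_rpow hx0, hℓ]
  -- `z ≤ w ≤ L`, `y ≥ 6`
  have hzw : z ≤ w := by
    rw [hz', hwexp]; refine Real.exp_le_exp.2 ?_
    have hL₁t : L₁ ≤ t := by
      have : Real.exp L₁ ≤ Real.exp t := by rw [hexpt]; exact hM1.trans hℓM
      exact Real.exp_le_exp.1 this
    have h := hL₁ t hL₁t
    rw [one_mul, hexpt] at h; linarith only [h]
  have hwL : w ≤ L := by
    rw [hw, hLdef]; refine Real.rpow_le_rpow_of_exponent_le hx1.le ?_; nlinarith only [hε, hε25]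
  have hy6 : 6 ≤ y := by
    have h4 := four_le_rpow_fiftieth hx100
    have h5 : (x : ℝ) ^ ((1 : ℝ) / 50) ≤ (x : ℝ) ^ ((1 : ℝ) / 5) :=
      Real.rpow_le_rpow_of_exponent_le hx1.le (by norm_num)
    have h6 : ((x : ℝ) ^ ((1 : ℝ) / 50)) ^ 2 ≤ y := by
      rw [hy, ← Real.rpow_natCast, ← Real.rpow_mul hx0.le]
      exact Real.rpow_le_rpow_of_exponent_le hx1.le (by norm_num)
    nlinarith only [h4, h6]
  -- products
  obtain ⟨Vshz, hVshz⟩ : ∃ v : ℝ, v = ∏ p ∈ (Finset.range ⌈z⌉₊).filter (fun p : ℕ => p.Prime ∧ p ≠ 2),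
    (1 - 1 / ((p : ℝ) - 1)) := ⟨_, rfl⟩
  obtain ⟨Vshw, hVshw⟩ : ∃ v : ℝ, v = ∏ p ∈ (Finset.range ⌈w⌉₊).filter (fun p : ℕ => p.Prime ∧ p ≠ 2),
    (1 - 1 / ((p : ℝ) - 1)) := ⟨_, rfl⟩
  obtain ⟨P1, hP1⟩ : ∃ v : ℝ, v = ∏ p ∈ (Nat.primesBelow ⌈w⌉₊).filter (fun p : ℕ => z ≤ (p : ℝ)),
    (1 - 1 / (p : ℝ)) := ⟨_, rfl⟩
  obtain ⟨P2, hP2⟩ : ∃ v : ℝ, v = ∏ p ∈ (Nat.primesBelow ⌈w⌉₊).filter (fun p : ℕ => z ≤ (p : ℝ)),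
    (1 - 1 / ((p : ℝ) - 1)) := ⟨_, rfl⟩
  have hVc : c / t ^ 4 ≤ V := by
    have h := hVlow z hz2.le; rw [hlogz, show (t ^ 2) ^ 2 = t ^ 4 by ring, ← hV] at h; exact h
  have hV0 : 0 < V := lt_of_lt_of_le (by positivity) hVc
  have hVshzV : Vshz ≤ 2 * V := by rw [hVshz, hV]; exact Vsh_le_two_mul_V hz2
  have hVshz0 : 0 ≤ Vshz := by
    have : V ≤ Vshz := by rw [hV, hVshz]; exact V_le_Vsh hz2
    linarith
  have hP10 : 0 ≤ P1 := by
    rw [hP1]; refine Finset.prod_nonneg fun p hp => ?_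
    have : (2 : ℝ) < p := by rw [Finset.mem_filter] at hp; linarith [hp.2]
    rw [sub_nonneg, div_le_one (by linarith)]; linarith
  have hVw : (∏ p ∈ (Finset.range ⌈w⌉₊).filter Nat.Prime, (1 - 1 / (p : ℝ))) = V * P1 := by
    rw [hV, hP1]; exact V_split hzw
  have hVwle : V * P1 ≤ 1 / Real.log w := by
    rw [← hVw]
    have hPB : Nat.primesBelow ⌈w⌉₊ = (Finset.range ⌈w⌉₊).filter Nat.Prime := rfl
    have h := BombieriSieve.prod_primesBelow_one_sub_inv_le (z := w) (by linarith)
    rw [hPB] at h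
    simpa only [one_div] using h
  have hVshwle : Vshw ≤ 2 / Real.log w := by rw [hVshw]; exact Vsh_le_div_log (by linarith)
  have hVzwle : Vshz * P1 ≤ 2 / Real.log w := by
    calc Vshz * P1 ≤ 2 * V * P1 := mul_le_mul_of_nonneg_right hVshzV hP10
      _ = 2 * (V * P1) := by ring
      _ ≤ 2 * (1 / Real.log w) := mul_le_mul_of_nonneg_left hVwle (by norm_num)
      _ = 2 / Real.log w := by ring
  have hVshw0 : 0 ≤ Vshw := by
    have h1 : (∏ p ∈ (Finset.range ⌈w⌉₊).filter Nat.Prime, (1 - 1 / (p : ℝ))) ≤ Vshw := by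
      rw [hVshw]; exact V_le_Vsh (by linarith)
    have h2 : 0 ≤ V * P1 := by positivity
    linarith [hVw]
  -- `E = e^{-1/ε}`
  obtain ⟨E, hEdef⟩ : ∃ v : ℝ, v = Real.exp (-(Real.log L / Real.log w)) := ⟨_, rfl⟩
  have hE : E = Real.exp (-(1 / ε)) := by
    rw [hEdef, hlogL, hlogw]; congr 2; field_simp
  have hE0 : 0 ≤ E := by rw [hEdef]; exact (Real.exp_pos _).le
  have hE1 : E ≤ 1 := by
    rw [hEdef]; refine Real.exp_le_one_iff.2 ?_
    have : 0 ≤ Real.log L / Real.log w := by rw [hlogL, hlogw]; positivity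
    linarith
  have hE6 : E ≤ 6 * ε ^ 3 := by rw [hE]; exact exp_neg_inv_le hε
  -- rewrite the goal with `G`, `w`, `D`, `y` and decompose over `d`
  subst hG
  simp only []
  rw [← hw, ← hℓ]
  have hGoal : ∀ m : ℕ, (∑ d ∈ (Nat.divisors m).filter (fun d : ℕ => (d : ℝ) ≤ (x : ℝ) ^ ((1 : ℝ) / 2 - 2 * ε) ∧
      ∀ p ∈ d.primeFactors, (x : ℝ) ^ ((1 : ℝ) / 5) ≤ (p : ℝ)), (ArithmeticFunction.moebius d : ℝ)) =
      ∑ d ∈ (Nat.divisors m).filter (fun d : ℕ => (d : ℝ) ≤ D ∧ ∀ p ∈ d.primeFactors, y ≤ (p : ℝ)),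
        (ArithmeticFunction.moebius d : ℝ) := by
    intro m; rw [hD, hy]
  simp only [hGoal]
  rw [typeI_decomp x z V w D y]
  refine (abs_sum_moebius_mul_le _ _).trans ?_
  obtain ⟨𝒟G, h𝒟G⟩ : ∃ S : Finset ℕ, S = (Finset.Icc 1 ⌊D⌋₊).filter (fun d : ℕ => (d : ℝ) ≤ D ∧
    ∀ p ∈ d.primeFactors, y ≤ (p : ℝ)) := ⟨_, rfl⟩
  obtain ⟨Ew, hEw⟩ : ∃ S : Finset ℕ, S = (primesProdBelow w).divisors.filter (fun e : ℕ => (e : ℝ) ≤ L) :=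
    ⟨_, rfl⟩
  rw [← h𝒟G]
  -- the bound for one `d`
  have hper : ∀ d ∈ 𝒟G,
      |(∑ n ∈ (Finset.Ioc x (2 * x)).filter (fun n : ℕ => n.Prime ∧ d ∣ n + 2 ∧ w ≤ ((n + 2).minFac : ℝ)),
          Real.log (n : ℝ)) -
        (1 / V) * (#((Finset.Ioc x (2 * x)).filter (fun n : ℕ => (∀ p ∈ n.primeFactors, z ≤ (p : ℝ)) ∧
          w ≤ ((n + 2).minFac : ℝ) ∧ d ∣ n + 2)) : ℝ)| ≤
      ((x : ℝ) / d) * (2 * C₁ * Vshw * E + 4 / z + 6 / y + Cb * (Vshz * P1) * E) +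
        ((∑ e ∈ Ew, |(∑ n ∈ (Finset.Ioc x (2 * x)).filter (fun n : ℕ => n.Prime ∧ d ∣ n + 2 ∧ e ∣ n + 2),
            Real.log (n : ℝ)) - shiftedPrimesDensity 2 e * ((x : ℝ) / (Nat.totient d : ℝ))|) +
          1 + Cb * (Vshz * P1) * E + L ^ 2 / V) := by
    intro d hd
    rw [h𝒟G, Finset.mem_filter, Finset.mem_Icc] at hd
    rw [hEw, hEdef]
    exact hPER x d z w L y D V Vshz Vshw P1 P2 hd.1.1 hd.2.1 hd.2.2 hx1' hz2 hzw hwL hwy hy6 hDy3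
      hV hV0 hVshz hVshw hP1 hP2
  -- notation for the pieces
  obtain ⟨Φ₁, hΦ₁⟩ : ∃ v : ℝ, v = 2 * C₁ * Vshw * E + 4 / z + 6 / y + Cb * (Vshz * P1) * E := ⟨_, rfl⟩
  obtain ⟨Φ₂, hΦ₂⟩ : ∃ v : ℝ, v = 1 + Cb * (Vshz * P1) * E + L ^ 2 / V := ⟨_, rfl⟩
  rw [← hΦ₁] at hper
  have hΦ₁0 : 0 ≤ Φ₁ := by rw [hΦ₁]; positivity
  have hΦ₂0 : 0 ≤ Φ₂ := by rw [hΦ₂]; positivity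
  have hsum1 := Finset.sum_le_sum hper
  -- `Σ_d 1/d ≤ S₁`, `#𝒟G ≤ D`, `#Ew ≤ L`
  have hyD : y ≤ D := by
    rw [hy, hD]; exact Real.rpow_le_rpow_of_exponent_le hx1.le (by linarith)
  have hy1' : 1 < y := by linarith
  have hS₁ : ∑ d ∈ 𝒟G, (1 : ℝ) / d ≤ S₁ := by
    have hratio : Real.log D / Real.log y ≤ 5 / 2 := by
      have hlD : Real.log D = (1 / 2 - 2 * ε) * ℓ := by rw [hD, Real.log_rpow hx0, hℓ]
      rw [hlD, hlogy, div_le_iff₀ (by positivity)]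
      nlinarith
    rw [h𝒟G, hS₁def]; exact sum_inv_moduli_le hCR hRough hy1' hyD hratio
  have hcardD : (#𝒟G : ℝ) ≤ D := by rw [h𝒟G]; exact card_moduli_le hD0.le
  have hcardE : (#Ew : ℝ) ≤ L := by rw [hEw]; exact card_levelDivisors_le hLpos.le
  -- the remainders: Bombieri–Vinogradov
  obtain ⟨Δ, hΔ⟩ : ∃ v : ℝ, v = ψ ((2 * x : ℕ) : ℝ) - θ ((2 * x : ℕ) : ℝ) := ⟨_, rfl⟩
  have hΔ0 : 0 ≤ Δ := by have := Chebyshev.theta_le_psi ((2 * x : ℕ) : ℝ); rw [hΔ]; linarith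
  obtain ⟨Q, hQ⟩ : ∃ q : ℕ, q = ⌊(((2 * x : ℕ) : ℝ)) ^ (1 / 2 - ε / 2 - ε / 2)⌋₊ := ⟨_, rfl⟩
  have hpair : ∀ d ∈ 𝒟G, ∀ e ∈ Ew, |(∑ n ∈ (Finset.Ioc x (2 * x)).filter (fun n : ℕ => n.Prime ∧
      d ∣ n + 2 ∧ e ∣ n + 2), Real.log (n : ℝ)) - shiftedPrimesDensity 2 e * ((x : ℝ) / (Nat.totient d : ℝ))| ≤
      2 * primeAPError ((2 * x : ℕ) : ℝ) (d * e) + Δ := by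
    intro d hd e he
    rw [h𝒟G, Finset.mem_filter, Finset.mem_Icc] at hd
    rw [hEw, Finset.mem_filter] at he
    rw [hΔ]
    exact host_rem_pair_le (by omega) hd.1.1 hd.2.2 (hz2.trans_le hzw) hwy (Nat.dvd_of_mem_divisors he.1)
  have hRa_le : ∑ d ∈ 𝒟G, (∑ e ∈ Ew, |(∑ n ∈ (Finset.Ioc x (2 * x)).filter (fun n : ℕ => n.Prime ∧ d ∣ n + 2 ∧ e ∣ n + 2),
            Real.log (n : ℝ)) - shiftedPrimesDensity 2 e * ((x : ℝ) / (Nat.totient d : ℝ))|) ≤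
      2 * ∑ q ∈ Finset.Icc 1 Q, primeAPError ((2 * x : ℕ) : ℝ) q + (#𝒟G : ℝ) * ((#Ew : ℝ) * Δ) := by
    have h1 : ∑ d ∈ 𝒟G, (∑ e ∈ Ew, |(∑ n ∈ (Finset.Ioc x (2 * x)).filter (fun n : ℕ => n.Prime ∧ d ∣ n + 2 ∧ e ∣ n + 2),
            Real.log (n : ℝ)) - shiftedPrimesDensity 2 e * ((x : ℝ) / (Nat.totient d : ℝ))|) ≤ ∑ d ∈ 𝒟G, ∑ e ∈ Ew, (2 * primeAPError ((2 * x : ℕ) : ℝ) (d * e) + Δ) :=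
      Finset.sum_le_sum fun d hd => Finset.sum_le_sum fun e he => hpair d hd e he
    refine h1.trans ?_
    have e1 : ∑ d ∈ 𝒟G, ∑ e ∈ Ew, (2 * primeAPError ((2 * x : ℕ) : ℝ) (d * e) + Δ) =
        2 * ∑ d ∈ 𝒟G, ∑ e ∈ Ew, primeAPError ((2 * x : ℕ) : ℝ) (d * e) + (#𝒟G : ℝ) * ((#Ew : ℝ) * Δ) := by
      simp only [Finset.sum_add_distrib, Finset.sum_const, nsmul_eq_mul, Finset.mul_sum]
    rw [e1]
    have h2 : ∑ d ∈ 𝒟G, ∑ e ∈ Ew, primeAPError ((2 * x : ℕ) : ℝ) (d * e) ≤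
        ∑ q ∈ Finset.Icc 1 Q, primeAPError ((2 * x : ℕ) : ℝ) q := by
      refine sum_pairs_le_sum_Icc 𝒟G Ew Q _ (y := y) (w := w) ?_ ?_ hwy ?_ (fun q => primeAPError_nonneg _ _)
      · intro d hd
        rw [h𝒟G, Finset.mem_filter, Finset.mem_Icc] at hd
        exact ⟨hd.1.1, hd.2.2⟩
      · intro e he
        rw [hEw, Finset.mem_filter] at he
        exact Nat.dvd_of_mem_divisors he.1
      · intro d hd e he
        rw [h𝒟G, Finset.mem_filter] at hd
        rw [hEw, Finset.mem_filter] at he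
        rw [hQ]
        refine Nat.le_floor ?_
        have hde : ((d * e : ℕ) : ℝ) ≤ D * L := by
          push_cast
          exact mul_le_mul hd.2.1 he.2 (Nat.cast_nonneg e) hD0.le
        refine hde.trans ?_
        rw [hD, hLdef, ← Real.rpow_add hx0]
        have e2 : (1 : ℝ) / 2 - 2 * ε + ε = 1 / 2 - ε / 2 - ε / 2 := by ring
        rw [e2]
        exact Real.rpow_le_rpow hx0.le (by push_cast; linarith) (by linarith)
    linarith only [h2]
  have hBV : ∑ q ∈ Finset.Icc 1 Q, primeAPError ((2 * x : ℕ) : ℝ) q ≤ CB * (2 * (x : ℝ)) / ℓ ^ 3 := by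
    have h2x : X₀ ≤ ((2 * x : ℕ) : ℝ) := by push_cast; linarith
    have h := hX₀ _ h2x
    rw [← hQ, Real.norm_of_nonneg (Finset.sum_nonneg fun q _ => primeAPError_nonneg _ _)] at h
    have hl2 : 0 < Real.log ((2 * x : ℕ) : ℝ) := Real.log_pos (by push_cast; linarith)
    have hpos : 0 < ((2 * x : ℕ) : ℝ) / Real.log ((2 * x : ℕ) : ℝ) ^ (3 : ℝ) := by
      apply div_pos (by push_cast; linarith)
      exact Real.rpow_pos_of_pos hl2 _
    rw [Real.norm_of_nonneg hpos.le] at h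
    refine h.trans ?_
    have hl2x : ℓ ≤ Real.log ((2 * x : ℕ) : ℝ) := by
      rw [hℓ]; push_cast; exact Real.log_le_log hx0 (by linarith)
    have e3 : Real.log ((2 * x : ℕ) : ℝ) ^ (3 : ℝ) = Real.log ((2 * x : ℕ) : ℝ) ^ (3 : ℕ) := by
      rw [← Real.rpow_natCast]; norm_num
    rw [e3, mul_div_assoc]
    refine mul_le_mul_of_nonneg_left ?_ hCB0
    have h2x0 : (0 : ℝ) < ((2 * x : ℕ) : ℝ) := by push_cast; linarith
    calc ((2 * x : ℕ) : ℝ) / Real.log ((2 * x : ℕ) : ℝ) ^ (3 : ℕ) ≤ ((2 * x : ℕ) : ℝ) / ℓ ^ 3 :=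
          div_le_div_of_nonneg_left h2x0.le (by positivity) (pow_le_pow_left₀ hℓ0.le hl2x 3)
      _ = 2 * (x : ℝ) / ℓ ^ 3 := by push_cast; ring
  have hΔle : Δ ≤ 4 * Real.sqrt x * (ℓ + 1) := by
    rw [hΔ, hℓ]; exact psi_sub_theta_window_le (by omega)
  -- assemble the total
  have hT : ∑ d ∈ 𝒟G, |(∑ n ∈ (Finset.Ioc x (2 * x)).filter (fun n : ℕ => n.Prime ∧ d ∣ n + 2 ∧
        w ≤ ((n + 2).minFac : ℝ)), Real.log (n : ℝ)) -
        (1 / V) * (#((Finset.Ioc x (2 * x)).filter (fun n : ℕ => (∀ p ∈ n.primeFactors, z ≤ (p : ℝ)) ∧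
          w ≤ ((n + 2).minFac : ℝ) ∧ d ∣ n + 2)) : ℝ)| ≤
      (x : ℝ) * S₁ * Φ₁ + 2 * ∑ q ∈ Finset.Icc 1 Q, primeAPError ((2 * x : ℕ) : ℝ) q +
        (#𝒟G : ℝ) * ((#Ew : ℝ) * Δ) + (#𝒟G : ℝ) * Φ₂ := by
    refine hsum1.trans ?_
    have h3 : ∑ d ∈ 𝒟G, ((∑ e ∈ Ew, |(∑ n ∈ (Finset.Ioc x (2 * x)).filter (fun n : ℕ => n.Prime ∧ d ∣ n + 2 ∧ e ∣ n + 2),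
            Real.log (n : ℝ)) - shiftedPrimesDensity 2 e * ((x : ℝ) / (Nat.totient d : ℝ))|) + 1 + Cb * (Vshz * P1) * E + L ^ 2 / V) = ∑ d ∈ 𝒟G, (∑ e ∈ Ew, |(∑ n ∈ (Finset.Ioc x (2 * x)).filter (fun n : ℕ => n.Prime ∧ d ∣ n + 2 ∧ e ∣ n + 2),
            Real.log (n : ℝ)) - shiftedPrimesDensity 2 e * ((x : ℝ) / (Nat.totient d : ℝ))|) + (#𝒟G : ℝ) * Φ₂ := by
      have hc : ∀ d : ℕ, (∑ e ∈ Ew, |(∑ n ∈ (Finset.Ioc x (2 * x)).filter (fun n : ℕ => n.Prime ∧ d ∣ n + 2 ∧ e ∣ n + 2),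
            Real.log (n : ℝ)) - shiftedPrimesDensity 2 e * ((x : ℝ) / (Nat.totient d : ℝ))|) + 1 + Cb * (Vshz * P1) * E + L ^ 2 / V = (∑ e ∈ Ew, |(∑ n ∈ (Finset.Ioc x (2 * x)).filter (fun n : ℕ => n.Prime ∧ d ∣ n + 2 ∧ e ∣ n + 2),
            Real.log (n : ℝ)) - shiftedPrimesDensity 2 e * ((x : ℝ) / (Nat.totient d : ℝ))|) + Φ₂ := fun d => by rw [hΦ₂]; ring
      rw [Finset.sum_congr rfl (fun d _ => hc d), Finset.sum_add_distrib, Finset.sum_const, nsmul_eq_mul]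
    have h4 : ∑ d ∈ 𝒟G, (x : ℝ) / d * Φ₁ = (x : ℝ) * Φ₁ * ∑ d ∈ 𝒟G, (1 : ℝ) / d := by
      rw [Finset.mul_sum]; exact Finset.sum_congr rfl (fun d _ => by ring)
    rw [Finset.sum_add_distrib, h3, h4]
    have h1 : (x : ℝ) * Φ₁ * ∑ d ∈ 𝒟G, (1 : ℝ) / d ≤ (x : ℝ) * S₁ * Φ₁ := by
      have h5 := mul_le_mul_of_nonneg_left hS₁ (by positivity : 0 ≤ (x : ℝ) * Φ₁)
      have e5 : (x : ℝ) * Φ₁ * S₁ = (x : ℝ) * S₁ * Φ₁ := by ring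
      linarith only [h5, e5]
    linarith only [h1, hRa_le]
  -- the remaining inputs of the final arithmetic
  have hVshz1 : Vshz ≤ 1 := by
    rw [hVshz]
    refine Finset.prod_le_one (fun p hp => ?_) (fun p hp => ?_)
    · obtain ⟨-, hpr, hne⟩ := Finset.mem_filter.1 hp
      have h3 : (3 : ℝ) ≤ p := by exact_mod_cast (by have := hpr.two_le; omega : 3 ≤ p)
      rw [sub_nonneg, div_le_one (by linarith)]; linarith
    · obtain ⟨-, hpr, hne⟩ := Finset.mem_filter.1 hp
      have h3 : (3 : ℝ) ≤ p := by exact_mod_cast (by have := hpr.two_le; omega : 3 ≤ p)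
      have : (0 : ℝ) ≤ 1 / ((p : ℝ) - 1) := by apply div_nonneg zero_le_one; linarith
      linarith
  have hP11 : P1 ≤ 1 := by
    rw [hP1]; refine Finset.prod_le_one (fun p hp => ?_) (fun p hp => ?_)
    · have : (2 : ℝ) < p := by rw [Finset.mem_filter] at hp; linarith [hp.2]
      rw [sub_nonneg, div_le_one (by linarith)]; linarith
    · have : (0 : ℝ) ≤ 1 / (p : ℝ) := by positivity
      linarith
  have hsqrt : Real.sqrt x = Real.exp (ℓ / 2) := by
    have hs0 : 0 < Real.sqrt x := Real.sqrt_pos.2 hx0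
    rw [← Real.exp_log hs0, Real.log_sqrt hx0.le, hℓ]
  rw [hsqrt] at hΔle
  have hL₂ℓ := hL₂ ℓ (hM3.trans hℓM)
  have hL₃ℓ := hL₃ ℓ (hM4.trans hℓM)
  rw [pow_one] at hL₂ℓ hL₃ℓ
  have hL₄ℓ := hL₄ ℓ (hM5.trans hℓM)
  have hL₅ℓ := hL₅ ℓ (hM6.trans hℓM)
  have hVshwle' : Vshw ≤ 2 / (ε ^ 2 * ℓ) := by rw [hlogw] at hVshwle; exact hVshwle
  have hVzwle' : Vshz * P1 ≤ 2 / (ε ^ 2 * ℓ) := by rw [hlogw] at hVzwle; exact hVzwle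
  rw [hΦ₁] at hT
  exact hT.trans (typeI_tail_arith hx0 hℓ3 hℓ0 hxℓ ht2 ht0 htℓ hexpt hz' hz2 hyexp hy0 hDexp hD0 hLexp hLpos
    hV0 hVc hVshz1 hP10 hP11 hVshwle' hVzwle' hE0 hE1 hE6 hΦ₂ hΦ₂0 hΔ0 hΔle hcardD hcardE (Nat.cast_nonneg _)
    hBV hCB0 hC₁ hCb hc hδ hε hε25 hS₁0 hK hK0 hεK hL₂ℓ hL₃ℓ hL₄ℓ hL₅ℓ (hM2.trans hℓM) (hM7.trans hℓM))

end Summit.Parity.GeneralizedHardyLittlewood.Theorems.ParityLeakOneFifth
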